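import Mathlib

/-! # The substitution `ε ↦ ε³`: stub `stub_ibqCube` of line `Sketch` (eps-order-ladder)
for crux `WordLengthQP` (stmt-ValiantsHypothesis-6623)

Helper file for the skeleton `Cruxes/WordLengthQP/Lines/Sketch.lean` of crux
`Summit.ValiantsHypothesis.ValiantsHypothesis.Theses.ElementaryWordLength.WordLengthQP`.

The predicate "`f : MvPolynomial σ ℂ` has an integral border Q-word of shift `≤ μ`, precision `κ`
and length `≤ L`" of the skeleton is SPELLED OUT (deliberately no definition): some list `w` of at
most `L` letters `((c, o), m) : (ℂ[ε] × Option σ) × ℕ`, read as the `2 × 2` matrices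
`[[C c · (1 | x_v), C ε^m], [C ε^m, 0]]` over `ℂ[ε][x_σ] = MvPolynomial σ (Polynomial ℂ)`
(`ε := Polynomial.X`), has product `C ε^M • Q(f) + C ε^(M+κ) • G` with `M ≤ μ` and `G` integral,
where `Q(f) = [[f, 1], [1, 0]]` (with `f` embedded by `MvPolynomial.map Polynomial.C`).

We prove `stub_ibqCube`: such a word of shift `≤ μ`, precision `κ`, length `≤ L` yields one of
shift `≤ 3 μ`, precision `3 κ`, length `≤ L`.  This is the remark "by replacing `ε` by `ε³` in all
primitive Q-matrices we obtain matrices in `Q(g) + O(ε³)`" in the proof of Prop. 3.5 of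
Bringmann–Ikenmeyer–Zuiddam, done in the integral model: apply the ring endomorphism
`θ = MvPolynomial.map (Polynomial.expand ℂ 3)` of `ℂ[ε][x_σ]` entrywise (`RingHom.mapMatrix`) to
the product equation.  `θ` fixes the variables and `Q(f)`, sends the letter `((c, o), m)` to the
letter `((expand 3 c, o), 3 m)`, and `C ε^M ↦ C ε^(3M)`, so shift and precision triple while the
length is unchanged.

Source: K. Bringmann, C. Ikenmeyer, J. Zuiddam, *On algebraic branching programs of small width*,
J. ACM 65 (2018) art. 32 (CCC 2017; arXiv:1702.05328), §3, proof of Prop. 3.5.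
Only Mathlib is used (`Polynomial.expand`, `MvPolynomial.map_map`, `map_list_prod`).
-/

-- `Summit.ValiantsHypothesis.ValiantsHypothesis.…` is the tree's mandated single-conjunct layout
-- (Sub = Summit), so the duplicated namespace component is intended.
set_option linter.dupNamespace false

noncomputable section

open MvPolynomial

namespace Summit.ValiantsHypothesis.ValiantsHypothesis.Cruxes.WordLengthQP.EpsOrderLadder

/-- `θ₃[σ]` (local notation, not a definition): the ring endomorphism of
`ℂ[ε][x_σ] = MvPolynomial σ (Polynomial ℂ)` substituting `ε ↦ ε³` in the coefficients, i.e.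
`MvPolynomial.map` of the ring hom underlying `Polynomial.expand ℂ 3`. -/
local notation3 (prettyPrint := false) "θ₃[" σ "]" =>
  (MvPolynomial.map (σ := σ)
    ((Polynomial.expand ℂ 3 : Polynomial ℂ →ₐ[ℂ] Polynomial ℂ) : Polynomial ℂ →+* Polynomial ℂ) :
      MvPolynomial σ (Polynomial ℂ) →+* MvPolynomial σ (Polynomial ℂ))

variable {σ : Type}

/-- `θ₃` on coefficients: `θ₃ (C c) = C (expand 3 c)`. -/
theorem epsCube_map_C (c : Polynomial ℂ) :
    θ₃[σ] (C c : MvPolynomial σ (Polynomial ℂ)) = C (Polynomial.expand ℂ 3 c) :=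
  MvPolynomial.map_C _ c

/-- `θ₃ (C ε^m) = C ε^(3 m)`. -/
theorem epsCube_map_C_X_pow (m : ℕ) :
    θ₃[σ] (C (Polynomial.X ^ m) : MvPolynomial σ (Polynomial ℂ)) = C (Polynomial.X ^ (3 * m)) := by
  rw [epsCube_map_C, map_pow, Polynomial.expand_X, ← pow_mul]

/-- `θ₃` fixes the scalar extensions `map C f` of polynomials `f` over `ℂ`
(`MvPolynomial.map_map` and `expand ∘ C = C`). -/
theorem epsCube_map_map_C (f : MvPolynomial σ ℂ) :
    θ₃[σ] (MvPolynomial.map Polynomial.C f) = MvPolynomial.map Polynomial.C f := by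
  have hc : ((Polynomial.expand ℂ 3 : Polynomial ℂ →ₐ[ℂ] Polynomial ℂ) :
      Polynomial ℂ →+* Polynomial ℂ).comp Polynomial.C = Polynomial.C :=
    RingHom.ext fun x => by simp
  rw [MvPolynomial.map_map, hc]

/-- `θ₃` applied entrywise commutes with scalar multiplication:
`θ₃ (r • A) = θ₃ r • θ₃ A`. -/
theorem epsCube_mapMatrix_smul (r : MvPolynomial σ (Polynomial ℂ))
    (A : Matrix (Fin 2) (Fin 2) (MvPolynomial σ (Polynomial ℂ))) :
    (θ₃[σ]).mapMatrix (r • A) = θ₃[σ] r • (θ₃[σ]).mapMatrix A :=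
  Matrix.ext fun i j => by simp

/-- `θ₃` applied entrywise fixes `Q(f) = [[f, 1], [1, 0]]`. -/
theorem epsCube_mapMatrix_Q (f : MvPolynomial σ ℂ) :
    (θ₃[σ]).mapMatrix (!![MvPolynomial.map Polynomial.C f, 1; 1, 0] :
        Matrix (Fin 2) (Fin 2) (MvPolynomial σ (Polynomial ℂ)))
      = !![MvPolynomial.map Polynomial.C f, 1; 1, 0] := by
  refine Matrix.ext fun i j => ?_
  fin_cases i <;> fin_cases j <;> simp [epsCube_map_map_C]

/-- `θ₃` applied entrywise maps the letter of `((c, o), m)` to the letter of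
`((expand 3 c, o), 3 m)`. -/
theorem epsCube_mapMatrix_letter (l : (Polynomial ℂ × Option σ) × ℕ) :
    (θ₃[σ]).mapMatrix (!![MvPolynomial.C l.1.1 * l.1.2.elim 1 MvPolynomial.X,
        MvPolynomial.C (Polynomial.X ^ l.2); MvPolynomial.C (Polynomial.X ^ l.2), 0] :
          Matrix (Fin 2) (Fin 2) (MvPolynomial σ (Polynomial ℂ)))
      = !![MvPolynomial.C (Polynomial.expand ℂ 3 l.1.1) * l.1.2.elim 1 MvPolynomial.X,
          MvPolynomial.C (Polynomial.X ^ (3 * l.2));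
          MvPolynomial.C (Polynomial.X ^ (3 * l.2)), 0] := by
  obtain ⟨⟨c, o⟩, m⟩ := l
  refine Matrix.ext fun i j => ?_
  fin_cases i <;> fin_cases j
  · cases o <;> simp
  · exact epsCube_map_C_X_pow (σ := σ) m
  · exact epsCube_map_C_X_pow (σ := σ) m
  · simp

/-- `θ₃` applied entrywise to the right-hand side `C ε^M • Q(f) + C ε^(M+κ) • G` of a border
Q-word equation gives `C ε^(3M) • Q(f) + C ε^(3M+3κ) • θ₃ G`. -/
theorem epsCube_mapMatrix_rhs (f : MvPolynomial σ ℂ) (M κ : ℕ)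
    (G : Matrix (Fin 2) (Fin 2) (MvPolynomial σ (Polynomial ℂ))) :
    (θ₃[σ]).mapMatrix
        ((MvPolynomial.C (Polynomial.X ^ M) : MvPolynomial σ (Polynomial ℂ)) •
            (!![MvPolynomial.map Polynomial.C f, 1; 1, 0] :
              Matrix (Fin 2) (Fin 2) (MvPolynomial σ (Polynomial ℂ)))
          + (MvPolynomial.C (Polynomial.X ^ (M + κ)) : MvPolynomial σ (Polynomial ℂ)) • G)
      = (MvPolynomial.C (Polynomial.X ^ (3 * M)) : MvPolynomial σ (Polynomial ℂ)) •
            (!![MvPolynomial.map Polynomial.C f, 1; 1, 0] :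
              Matrix (Fin 2) (Fin 2) (MvPolynomial σ (Polynomial ℂ)))
          + (MvPolynomial.C (Polynomial.X ^ (3 * M + 3 * κ)) : MvPolynomial σ (Polynomial ℂ)) •
            (θ₃[σ]).mapMatrix G := by
  rw [map_add, epsCube_mapMatrix_smul, epsCube_mapMatrix_smul, epsCube_map_C_X_pow,
    epsCube_map_C_X_pow, epsCube_mapMatrix_Q, mul_add]

/-- **stub_ibqCube** (BIZ18, proof of Prop. 3.5: "replacing `ε` by `ε³`"): an integral border
Q-word for `f` of shift `≤ μ`, precision `κ`, length `≤ L` yields one of shift `≤ 3 μ`, precision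
`3 κ`, length `≤ L`.  Proof: apply the ring map `θ₃ = MvPolynomial.map (Polynomial.expand ℂ 3)`
entrywise (`RingHom.mapMatrix`, `map_list_prod`) to the product equation; a letter `((c, o), m)`
becomes the letter `((expand 3 c, o), 3 m)`, `Q(f)` is fixed, shift and precision triple. -/
theorem stub_ibqCube :
    ∀ {σ : Type} (f : MvPolynomial σ ℂ) (μ κ L : ℕ),
      (∃ w : List ((Polynomial ℂ × Option σ) × ℕ), w.length ≤ L ∧ ∃ M : ℕ, M ≤ μ ∧
        ∃ G : Matrix (Fin 2) (Fin 2) (MvPolynomial σ (Polynomial ℂ)),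
          (w.map (fun l => (!![MvPolynomial.C l.1.1 * l.1.2.elim 1 MvPolynomial.X,
              MvPolynomial.C (Polynomial.X ^ l.2); MvPolynomial.C (Polynomial.X ^ l.2), 0] :
                Matrix (Fin 2) (Fin 2) (MvPolynomial σ (Polynomial ℂ))))).prod
            = (MvPolynomial.C (Polynomial.X ^ M) : MvPolynomial σ (Polynomial ℂ)) •
                (!![MvPolynomial.map Polynomial.C f, 1; 1, 0] :
                  Matrix (Fin 2) (Fin 2) (MvPolynomial σ (Polynomial ℂ)))
              + (MvPolynomial.C (Polynomial.X ^ (M + κ)) : MvPolynomial σ (Polynomial ℂ)) • G) →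
      (∃ w : List ((Polynomial ℂ × Option σ) × ℕ), w.length ≤ L ∧ ∃ M : ℕ, M ≤ 3 * μ ∧
        ∃ G : Matrix (Fin 2) (Fin 2) (MvPolynomial σ (Polynomial ℂ)),
          (w.map (fun l => (!![MvPolynomial.C l.1.1 * l.1.2.elim 1 MvPolynomial.X,
              MvPolynomial.C (Polynomial.X ^ l.2); MvPolynomial.C (Polynomial.X ^ l.2), 0] :
                Matrix (Fin 2) (Fin 2) (MvPolynomial σ (Polynomial ℂ))))).prod
            = (MvPolynomial.C (Polynomial.X ^ M) : MvPolynomial σ (Polynomial ℂ)) •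
                (!![MvPolynomial.map Polynomial.C f, 1; 1, 0] :
                  Matrix (Fin 2) (Fin 2) (MvPolynomial σ (Polynomial ℂ)))
              + (MvPolynomial.C (Polynomial.X ^ (M + (3 * κ))) : MvPolynomial σ (Polynomial ℂ)) • G) := by
  intro σ f μ κ L ⟨w, hw, M, hM, G, hG⟩
  refine ⟨w.map (fun l => ((Polynomial.expand ℂ 3 l.1.1, l.1.2), 3 * l.2)),
    by rw [List.length_map]; exact hw, 3 * M, by omega, (θ₃[σ]).mapMatrix G, ?_⟩
  have h := congrArg (θ₃[σ]).mapMatrix hG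
  rw [map_list_prod, List.map_map, epsCube_mapMatrix_rhs] at h
  simp only [Function.comp_def, epsCube_mapMatrix_letter] at h
  simpa only [List.map_map, Function.comp_def] using h

end Summit.ValiantsHypothesis.ValiantsHypothesis.Cruxes.WordLengthQP.EpsOrderLadder
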